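import Summits.Ventures.HSemireg.Pad4TowerSeedB1OddLemmas
import Summits.Ventures.HSemireg.Pad4TowerCleanCellOrbits

/-!
# Venture HSemireg — PAD-4 on 𝔅(μ₄): LINE 5 (iii) STATIC-LEMMA SIGNATURE (T′-a), SEED HALF — the `G₁` bookkeeping half of (B1-odd)
# PROVED ((σ-R): odd FC class present ⟺ pattern-`0001` FC class present), the shape `LocalKill` of a local kill lemma, and the two
# SHARPER TARGETS in HYPOTHESIS FORM: (W) `SeedFCDiagonalUnitDiamond8G1H1` «every present FC cell is a diagonal unit cell» and (W′)
# `SeedFCPCeilingUnitDiamond8G1H1` «the only present FC cell is the P-frame ceiling unit cell» — with (W′) ⇒ (W) ⇒ (T), (S) and the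
# case-list assemblies PROVED; and LINE 5 SEED (B2) `SeedB2Diamond8G1H2` («H₂-static + FC present ⇒ ¬ Ψ-clause», `H₂ = H₁`, r3 ×2, NO proof)
# with its PROVED corollary `wch_eWord_eq_zero_of_seedB2`

HONEST FRAMING. Lean index of the computation cell `pub-hsemireg` (S4-PUSH, H2 door PAD-4), typed by the Ventures-side typer
`hodge-lit-semireg-typer-2` (g6; line of record stmt-HodgeConjecture-18881 `Cruxes/BlochSeedDiscOne/Lines/birth.lean` 814a6a70c14e831a,
stub `stub_rung_pad4_seedAt`). Sequel of (S) `Pad4TowerSeedB1`, (T) `Pad4TowerSeedB1Odd` and gs-eng-2 g53's `Pad4TowerSeedB1OddLemmas` (LEMMA C ∕ L ∕ U kernel kills;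
its `cu8` = the ceiling unit letter `6I+ℓ_u` is reused, not redeclared); sibling `Pad4TowerStaticTorus` (the torus half of
(T′-a): (σ-T) ∕ (σ-T′) ∕ (σ-N) — split off only because Theorems files with proofs are ≤ 400 lines). BYTES OF RECORD: bc5-plan g8's
`SketchStaticTorus.lean` v3.2 47a52d8ed73fcbfe (cell `hodge-bloch-bc5-plan∕work∕g8∕lean∕`; v3 bfdd78d090f0d634 = + (σ-D) after gs-eng-2 g53's
AGREE l.32711 «make the conclusion: every present FC cell is a DIAGONAL UNIT cell»; v3.1 = the name `SeedFCDiagonalUnitDiamond8G1H1` per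
director-hodge g14 R14.16 (1) «ADOPTED as THE LINE 5 (iii) TARGET (W)»; v3.2 = + (σ-D′) the sharper target (W′) per R14.22 (1) after g53's ◇₈
peel; R14.23 (2) «fold the (W′) block») — definitions and proof bodies VERBATIM from the sketch; module text, docstrings and probe names by the
typer. Pencil ∕ machine of record: gs-eng-2 g53 `general-structure∕PENCIL-B1ODD-gs2g53.md` v0.1 efb274008ca24bf4 (§2 LEMMA C) and v0.2
53221347e5eec278 (case table), third code kit j309715 (table) and j309861 (peel).

STATUS WORDS. **(W) `SeedFCDiagonalUnitDiamond8G1H1` and (W′) `SeedFCPCeilingUnitDiamond8G1H1` are TYPED STATEMENTS IN HYPOTHESIS FORM** —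
`def … : Prop`, NOT asserted, no `axiom`, no `sorry`, NO proof. Evidence for (W): THIRD CODE ×1 (g53, kit j309715: `G₁`-orbit CNF built from
the Lean predicates, 97 660 variables, 11 888 807 clauses, no auxiliary variables; kissat) — «FC with ≥ 2 distinct letters present» UNSAT
48.5 s, «diagonal FC `[x]⁴` with `x` neither a ceiling unit `6I+ℓ_u` nor a floor unit `ℓ_u`» UNSAT 51.5 s, «any FC» SAT 52.5 s (FC exists at
`h = 8`); ENCODER ×2 (bc5-plan g8, kit j310554 `W-DIAGUNIT-D8-G1-v19`, cell INBOX l.32846, R14.16 (2): on 12 276 316 ∕ 50 851 365 = STATIC(H₁) +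
FC-mass + one presence selector, `multi_fc` «some FC class with ≥ 2 distinct letters» kissat UNSAT 1 064 s + cadical UNSAT 573 s, `diag_nonunit_fc`
«some diagonal FC class `[x]⁴`, `x ∉ {ℓ_u, 6I+ℓ_u}`» kissat UNSAT 325 s + cadical UNSAT 572 s) — two code bases, three solver families, instance
level, ◇₈ only; still NO proof. Evidence for (W′): THIRD CODE ×1, search-free — g53's ◇₈ PEEL (kit j309861: propagation-only failed-literal elimination on the
`H₁` orbit-CNF reaches a fixpoint after 17 rounds having eliminated 97 541 of 97 660 orbit literals — all 30 800 odd-FC literals, 31 019 of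
31 020 even-FC literals; the ONE surviving FC orbit literal is `P[6I+ℓ_u]⁴`); (W) stays THE typed target of record until (W′) is ×2
(R14.22 (1)). R14.23 (1): (T) ∕ (S) ∕ (W) ∕ (W′) STAY hypothesis-form on this desk; the evidence stack (2 encoders × 2 solvers, third code,
DRAT ∕ DRUP certificates) does NOT move H2's status word — machine ≠ kernel. **PROVED here**: **(σ-R) `oddFCPatternOneReduction_holds`** (on a
`G₁`-closed support in ◇₈: `HasOddFC ↔ HasFC 1`); **`seedB1Odd_of_cases`**; `MCell.pat_of_isDiag` (a diagonal cell has pattern `0000`∕`1111`);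
**`seedB1Odd_of_diagUnit`** ((W) ⇒ (T)), **`seedB1_of_diagUnit`** ((W) ⇒ (S)), **`seedDiagUnit_of_cases`**; **`seedDiagUnit_of_pCeilingUnit`**
((W′) ⇒ (W)), `seedB1Odd_of_pCeilingUnit`, `seedB1_of_pCeilingUnit`, **`seedPCeilingUnit_of_cases`**. So ONE kernel proof of (W′) or (W) — in
whatever architecture the human admits (R14.23 (3): a quarantined certificate checker is a DECISION FOR THE HUMAN) — would yield (T) AND (S) and
hence the landed corollaries `wch_eWord_eq_zero_of_seedB1` ∕ `…_of_seedB1Odd`.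

CONTENT. §1 (σ-R) `OddFCPatternOneReduction` + `_holds` (odd ⇒ weight 1 or 3; weight 3 ⇒ `Δ` gives weight 1 on axis cells, `MCell.pwt_delta`,
axis from ◇₈; weight 1 ⇒ one factor swap gives `0001`, `MCell.pat_perm_of_bits`; converse = (T) `hasOddFC_of_hasFC_one`); (σ-K)
`LocalKill triggersN triggersP` (one case-list entry with NO `G₁` inside: the `G₁`-images a kill needs are LISTED as triggers and supplied by
`G1Closed` at assembly; LEMMA C of the pencil = `triggersN = {q°}`, `triggersP = {Z°, n°}`; gs-eng-2's `Pad4TowerSeedB1OddLemmas` holds the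
first instances); `seedB1Odd_of_cases` (the case list need only cover the pattern-`0001` classes). §2 (W): `MCell.IsDiag`,
`MCell.IsDiagUnit8` (`[ℓ_u]⁴` or `[6I+ℓ_u]⁴`), `pat_diag_cases` ∕ `MCell.pat_of_isDiag` ∕ `not_oddPat_of_isDiag` ∕ `pat_ne_three_of_isDiag`,
the seed, the two implications, the case assembly. §3 (W′): `MCell.IsCeilingUnit8`, `isDiagUnit8_of_isCeilingUnit8`, the seed, (W′) ⇒ (W) ⇒
(T), (S), the case assembly `seedPCeilingUnit_of_cases` (no FC `N`-cell at all; every non-ceiling-unit FC `P`-cell contradictory).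
§4 (B2) (folded here per R14.32 (1)): `MConfig.StaticH2 := StaticH1` (r3 FINAL: `H₂ = H₁`), `MConfig.HasAnyFC` (FC-mass, decidable) +
`hasAnyFC_of_hasSignedFC` ∕ `_of_fcCoreBlock`, **`SeedB2Diamond8G1H2 : Prop := ∀ C, C.InDiamond 8 → C.G1Closed → C.StaticH2 → C.HasAnyFC →
¬ C.PsiClause`** (HYPOTHESIS FORM; kit j305149 r3 ×2: kissat `all` 2 362 s, cadical minimal 12 276 318 ∕ 50 943 884 UNSAT 837 s; NO proof),
`SeedB2Diamond8G1Static4` + `seedB2Static4_of_H2`, PROVED corollaries **`wch_eWord_eq_zero_of_seedB2`** ∕ `…Static4` (seed + positive multiplicities +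
(A1) class screen ⇒ `μ = 0`, via (B) `psiClause_of_classScreen` and (S) `fcCoreBlock_of_classScreen`). §5 probes (`decide`): `IsDiagUnit8` ∕
`IsCeilingUnit8` compute on unit cells; `[6I+ℓ_u]⁴ ∈ ◇₈`; `HasAnyFC` ∕ Ψ-clause on `diagFour`.

WHAT IS NOT HERE ∕ NOT IN LEAN. No proof of (W) ∕ (W′) ∕ (T) ∕ (S) ∕ (B2); no case list and no `LocalKill` instance ((T′-b) CANCELLED, R14.23 (2):
the peel is ≈ 10⁵ lemmas deep in 17 layers); no encoder ×2 verdict; no (B2) ∕ r3, no `G′` form. NOTHING HERE SAYS THAT (S) ∕ (T) ∕ (W) ∕ (W′) ∕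
(B2) ∕ H2 ∕ HC ∕ HC_CM ∕ HC_AV ∕ W₆ ∕ HC_Kum4Type HOLDS OR FAILS; typed ≠ proved ≠ endorsed; machine ≠ kernel. No `instance`, no notation, no attribute,
no Literature fact, 0 `sorry`; axioms standard.
-/

namespace Summit.Ventures.HSemireg.Pad4Tower

open Finset

/-! ## §1 (σ-R) the `G₁` bookkeeping half of (B1-odd), PROVED; the shape (σ-K) of a local kill; the assembly `seedB1Odd_of_cases` -/

/-- **(σ-R) `OddFCPatternOneReduction` — the `G₁` bookkeeping half of (B1-odd).** On a `G₁`-closed support inside ◇₈ an odd-weight FC class is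
present iff an FC class of the single pattern `0001` (κ = 1) is present (inside ◇₈ FC cells are axis cells): `Δ` flips all four phase bits
(weight `w ↦ 4 − w`), `S₄` permutes them, so the eight odd patterns are ONE `G₁`-orbit. Reduces the case list of (T) to the pattern-`0001` classes.
PROVED: `oddFCPatternOneReduction_holds`. -/
def OddFCPatternOneReduction : Prop :=
  ∀ C : MConfig, C.InDiamond 8 → C.G1Closed → (C.HasOddFC ↔ C.HasFC 1)

/-- the weight-one patterns are `0001, 0010, 0100, 1000`. [`decide`] -/
theorem pwt_eq_one_cases : ∀ κ : Fin 16, pwt κ = 1 → κ = 1 ∨ κ = 2 ∨ κ = 4 ∨ κ = 8 := by decide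

/-- an odd parity weight is `1` or `3`. [`decide`] -/
theorem oddPat_pwt_cases : ∀ κ : Fin 16, OddPat κ → pwt κ = 1 ∨ pwt κ = 3 := by decide

/-- a weight-one cell has an `S₄`-image of pattern `0001` (one transposition moving the imaginary factor to slot 3; `MCell.pat_perm_of_bits`). -/
theorem MCell.exists_perm_pat_one (Z : MCell) (h1 : pwt Z.pat = 1) : ∃ σ : Equiv.Perm (Fin 4), (Z.perm σ).pat = 1 := by
  rcases pwt_eq_one_cases Z.pat h1 with h | h | h | h
  · exact ⟨1, Z.pat_perm_of_bits 1 h (by decide)⟩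
  · exact ⟨Equiv.swap 2 3, Z.pat_perm_of_bits _ h (by decide)⟩
  · exact ⟨Equiv.swap 1 3, Z.pat_perm_of_bits _ h (by decide)⟩
  · exact ⟨Equiv.swap 0 3, Z.pat_perm_of_bits _ h (by decide)⟩

/-- an odd axis cell has parity weight one itself or after `Δ` (`MCell.pwt_delta`: `|ρ(ΔZ)| = 4 − |ρ(Z)|` on axis cells). -/
theorem MCell.pwt_one_or_delta (Z : MCell) (hax : AxisCell Z) (hodd : OddPat Z.pat) : pwt Z.pat = 1 ∨ pwt Z.delta.pat = 1 := by
  rcases oddPat_pwt_cases Z.pat hodd with h | h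
  · exact Or.inl h
  · exact Or.inr (by rw [Z.pwt_delta hax, h])

/-- **(σ-R) PROVED.** [odd ⇒ weight 1 or 3; weight 3 ⇒ `Δ` gives weight 1 (axis cells, from ◇₈ via `MConfig.axisCell_of_inDiamond`); weight 1 ⇒
a factor swap gives `0001`; `PermClosed` ∕ `DeltaClosed` keep the images present and `fcc_perm` ∕ `fcc_delta` keep them fully charged; converse =
(T) `MConfig.hasOddFC_of_hasFC_one`. bc5-plan g8 sketch, verbatim.] -/
theorem oddFCPatternOneReduction_holds : OddFCPatternOneReduction := by
  intro C hU hG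
  refine ⟨fun hodd => ?_, MConfig.hasOddFC_of_hasFC_one⟩
  obtain ⟨hl, hu, hdl, hdu⟩ := hG
  have hax := MConfig.axisCell_of_inDiamond hU
  -- one level at a time: from an odd FC cell `Z` at a level closed under `S₄` and `Δ`, produce a pattern-`0001` FC cell at the same level
  have key : ∀ S : Finset MCell, PermClosed S → DeltaClosed S → (∀ Z ∈ S, FCc Z → AxisCell Z) →
      ∀ Z ∈ S, FCc Z → OddPat Z.pat → ∃ W ∈ S, FCc W ∧ W.pat = 1 := by
    intro S hp hd hS Z hZ hfc hodd
    rcases Z.pwt_one_or_delta (hS Z hZ hfc) hodd with h | h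
    · obtain ⟨σ, hσ⟩ := Z.exists_perm_pat_one h
      exact ⟨Z.perm σ, hp σ Z hZ, MCell.fcc_perm hfc σ, hσ⟩
    · obtain ⟨σ, hσ⟩ := Z.delta.exists_perm_pat_one h
      exact ⟨Z.delta.perm σ, hp σ _ (hd Z hZ), MCell.fcc_perm (MCell.fcc_delta hfc) σ, hσ⟩
  rcases hodd with ⟨Z, hZ, hfc, hp⟩ | ⟨P, hP, hfc, hp⟩
  · obtain ⟨W, hW, hWfc, hWp⟩ := key C.lower hl hdl hax.1 Z hZ hfc hp
    exact ⟨W, Or.inl hW, hWfc, hWp⟩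
  · obtain ⟨W, hW, hWfc, hWp⟩ := key C.upper hu hdu hax.2 P hP hfc hp
    exact ⟨W, Or.inr hW, hWfc, hWp⟩

/-- **(σ-K) `LocalKill` — the SHAPE of one case-list entry (g53's half (b)): a LOCAL KILL LEMMA.** Trigger cells present at levels `N`
(`triggersN ⊆ C.lower`) and `P` (`triggersP ⊆ C.upper`) + `StaticH1` inside ◇₈ ⇒ contradiction, with NO `G₁` inside: the `G₁`-images a kill
needs are LISTED among the triggers and supplied by `G1Closed` at assembly. LEMMA C of the pencil = the instance `triggersN = {q°}`,
`triggersP = {Z°, n°}` (gs-eng-2's `Pad4TowerSeedB1OddLemmas` holds the first kills: `xplus_ceiling_kill` ∕ `lift_of_ceiling_unit` ∕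
`cancellation_of_floor_unit`); (σ-T) (`Pad4TowerStaticTorus`) transports a kill proved at ONE phase normalisation to its `η`-rotates. No
instance is proved in this file. -/
def LocalKill (triggersN triggersP : Finset MCell) : Prop :=
  ∀ C : MConfig, C.InDiamond 8 → C.StaticH1 → triggersN ⊆ C.lower → triggersP ⊆ C.upper → False

/-- **the ASSEMBLY, PROVED**: how (σ-R) + a case list of (σ-K)-lemmas closes (T). If every pattern-`0001` FC class `Z` inside ◇₈, at either level of
a `G₁`-closed `H₁`-static support, is contradictory (abstracted as the hypothesis `hcases`; each case would be a `LocalKill` instance whose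
triggers are `G₁`-images of `Z`), then `SeedB1OddDiamond8G1H1`. [(σ-R) `oddFCPatternOneReduction_holds` + `hcases`; bc5-plan g8 sketch, verbatim] -/
theorem seedB1Odd_of_cases
    (hcases : ∀ C : MConfig, C.InDiamond 8 → C.G1Closed → C.StaticH1 → ∀ Z, (Z ∈ C.lower ∨ Z ∈ C.upper) → FCc Z → Z.pat = 1 → False) :
    SeedB1OddDiamond8G1H1 := by
  intro C hU hG hS hodd
  obtain ⟨Z, hZ, hfc, hp⟩ := (oddFCPatternOneReduction_holds C hU hG).mp hodd
  exact hcases C hU hG hS Z hZ hfc hp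

/-! ## §2 (W) = (σ-D) THE TARGET OF RECORD (R14.16 (1)), proposed by gs-eng-2 g53: under ◇₈ + `G₁` + `H₁` every present FC cell is a DIAGONAL
UNIT cell — hypothesis form; (W) ⇒ (T) and (W) ⇒ (S) PROVED; the case-list assembly for (W) -/

-- `cu8 u = ray (6, 0, 0) u 1` (the ceiling unit letter `6I + ℓ_u`, the point `(7, ū)`) is gs-eng-2 g53's `Pad4TowerSeedB1OddLemmas.cu8` (imported).

/-- a DIAGONAL cell: all four factors carry the same letter (phase included). -/
def MCell.IsDiag (Z : MCell) : Prop := ∀ f, Z f = Z 0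

/-- a DIAGONAL UNIT cell of ◇₈: `[ℓ_u]⁴` (floor unit) or `[6I+ℓ_u]⁴` (ceiling unit) for one phase `u`. -/
def MCell.IsDiagUnit8 (Z : MCell) : Prop := ∃ u : Fin 4, (∀ f, Z f = lpt 1 u) ∨ (∀ f, Z f = cu8 u)

/-- a diagonal unit cell is diagonal. -/
theorem MCell.isDiag_of_isDiagUnit8 {Z : MCell} (h : Z.IsDiagUnit8) : Z.IsDiag := by
  obtain ⟨u, h | h⟩ := h <;> intro f <;> rw [h f, h 0]

/-- the sixteen patterns: constant bits means `0000` or `1111`. [`decide`] -/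
theorem pat_diag_cases : ∀ κ : Fin 16, (∀ f : Fin 4, bitOf κ f = bitOf κ 0) → κ = 0 ∨ κ = 15 := by decide

/-- a diagonal cell has pattern `0000` or `1111` (`bitOf_pat`). -/
theorem MCell.pat_of_isDiag {Z : MCell} (h : Z.IsDiag) : Z.pat = 0 ∨ Z.pat = 15 :=
  pat_diag_cases Z.pat fun f => by rw [bitOf_pat, bitOf_pat, h f]

/-- hence a diagonal cell never has an odd pattern … -/
theorem MCell.not_oddPat_of_isDiag {Z : MCell} (h : Z.IsDiag) : ¬ OddPat Z.pat := by
  rcases Z.pat_of_isDiag h with hp | hp <;> rw [hp] <;> decide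

/-- … and never the weight-2 pattern `0011` nor the weight-1 pattern `0001` (the two FC-CORE entries used by (S)). -/
theorem MCell.pat_ne_three_of_isDiag {Z : MCell} (h : Z.IsDiag) : Z.pat ≠ 3 ∧ Z.pat ≠ 1 := by
  rcases Z.pat_of_isDiag h with hp | hp <;> rw [hp] <;> decide

/-- **(W) = (σ-D) `SeedFCDiagonalUnitDiamond8G1H1` — THE LINE 5 (iii) TARGET OF RECORD (director-hodge g14 R14.16 (1); proposed by gs-eng-2 g53,
cell INBOX l.32711 (2)); TYPED STATEMENT IN HYPOTHESIS FORM, NOT asserted, no proof**: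
◇₈ + `G₁`-closed levels + `H₁`-static ⇒ every present fully charged cell is a diagonal unit cell `[ℓ_u]⁴` or `[6I+ℓ_u]⁴` («(CUL-8) in its sharpest
form»). Machine ×1 on a THIRD CODE (g53, kit j309715: `G₁`-orbit CNF from the Lean predicates, 97 660 variables, 11 888 807 clauses; kissat): «FC
with ≥ 2 distinct letters» UNSAT 48.5 s, «diagonal FC `[x]⁴`, `x` not a unit letter» UNSAT 51.5 s, «any FC» SAT 52.5 s; MACHINE ×2 on the ENCODER
OF RECORD (bc5-plan g8, kit j310554, cell INBOX l.32846; CNF 12 276 316 ∕ 50 851 365): `multi_fc` kissat UNSAT 1 064 s + cadical UNSAT 573 s,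
`diag_nonunit_fc` kissat UNSAT 325 s + cadical UNSAT 572 s — instance level, ◇₈ only, says nothing at `h ≠ 8`; typed ≠ proved. Implies (T) and (S)
(`seedB1Odd_of_diagUnit`, `seedB1_of_diagUnit`, PROVED). -/
def SeedFCDiagonalUnitDiamond8G1H1 : Prop :=
  ∀ C : MConfig, C.InDiamond 8 → C.G1Closed → C.StaticH1 → ∀ Z, (Z ∈ C.lower ∨ Z ∈ C.upper) → FCc Z → Z.IsDiagUnit8

/-- **(W) ⇒ (T), PROVED**: a diagonal cell has pattern `0000` ∕ `1111`, never odd. [bc5-plan g8 sketch v3, verbatim] -/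
theorem seedB1Odd_of_diagUnit (h : SeedFCDiagonalUnitDiamond8G1H1) : SeedB1OddDiamond8G1H1 := by
  intro C hU hG hS hodd
  rcases hodd with ⟨Z, hZ, hfc, hp⟩ | ⟨P, hP, hfc, hp⟩
  · exact MCell.not_oddPat_of_isDiag (MCell.isDiag_of_isDiagUnit8 (h C hU hG hS Z (Or.inl hZ) hfc)) hp
  · exact MCell.not_oddPat_of_isDiag (MCell.isDiag_of_isDiagUnit8 (h C hU hG hS P (Or.inr hP) hfc)) hp

/-- **(W) ⇒ (S), PROVED**: the even half of `FCCoreBlock` needs a pattern-`0011` FC class (`HasSignedFC 3 (−s)`), the odd half a pattern-`0001`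
one (`HasSignedFC 1 t`); diagonal cells have neither. [bc5-plan g8 sketch v3, verbatim] -/
theorem seedB1_of_diagUnit (h : SeedFCDiagonalUnitDiamond8G1H1) : SeedB1Diamond8G1H1 := by
  intro C hU hG hS hblock
  have hdiag : ∀ Z, (Z ∈ C.lower ∨ Z ∈ C.upper) → FCc Z → Z.IsDiag := fun Z hZ hfc =>
    MCell.isDiag_of_isDiagUnit8 (h C hU hG hS Z hZ hfc)
  rcases hblock with ⟨s, -, hev⟩ | ⟨t, -, hod⟩
  · rcases hev.2.2.1 with ⟨Z, hZ, hfc, hp, -⟩ | ⟨P, hP, hfc, hp, -⟩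
    · exact (MCell.pat_ne_three_of_isDiag (hdiag Z (Or.inl hZ) hfc)).1 hp
    · exact (MCell.pat_ne_three_of_isDiag (hdiag P (Or.inr hP) hfc)).1 hp
  · rcases hod.1 with ⟨Z, hZ, hfc, hp, -⟩ | ⟨P, hP, hfc, hp, -⟩
    · exact (MCell.pat_ne_three_of_isDiag (hdiag Z (Or.inl hZ) hfc)).2 hp
    · exact (MCell.pat_ne_three_of_isDiag (hdiag P (Or.inr hP) hfc)).2 hp

/-- **the CASE-LIST ASSEMBLY for (W), PROVED**: if every present NON-diagonal-unit FC cell is contradictory under ◇₈ + `G₁` + `H₁` (local kills in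
the shape `LocalKill`), the seed (W) holds. [classical case split; bc5-plan g8 sketch v3, verbatim] -/
theorem seedDiagUnit_of_cases
    (hcases : ∀ C : MConfig, C.InDiamond 8 → C.G1Closed → C.StaticH1 →
      ∀ Z, (Z ∈ C.lower ∨ Z ∈ C.upper) → FCc Z → ¬ Z.IsDiagUnit8 → False) :
    SeedFCDiagonalUnitDiamond8G1H1 :=
  fun C hU hG hS Z hZ hfc => Classical.by_contradiction (hcases C hU hG hS Z hZ hfc)

/-! ## §3 (W′) = (σ-D′) THE SHARPER TARGET recorded by director-hodge g14 R14.22 (1) from gs-eng-2 g53's ◇₈ PEEL: under ◇₈ + `G₁` + `H₁` NO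
`N`-frame FC cell is present and every present `P`-frame FC cell is a ceiling unit cell `[6I+ℓ_u]⁴` — hypothesis form; (W′) ⇒ (W) ⇒ (T), (S) -/

/-- a `P`-frame CEILING UNIT cell of ◇₈: `[6I+ℓ_u]⁴` for one phase `u`. -/
def MCell.IsCeilingUnit8 (Z : MCell) : Prop := ∃ u : Fin 4, ∀ f, Z f = cu8 u

/-- a ceiling unit cell is a diagonal unit cell. -/
theorem MCell.isDiagUnit8_of_isCeilingUnit8 {Z : MCell} (h : Z.IsCeilingUnit8) : Z.IsDiagUnit8 := by
  obtain ⟨u, h⟩ := h; exact ⟨u, Or.inr h⟩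

/-- **(W′) = (σ-D′) `SeedFCPCeilingUnitDiamond8G1H1` — THE SHARPER TARGET (director-hodge g14 R14.22 (1)); TYPED STATEMENT IN HYPOTHESIS FORM,
NOT asserted, no proof**: ◇₈ + `G₁`-closed levels + `H₁`-static ⇒ NO fully charged `N`-cell (`C.lower`) is present, and every present fully charged
`P`-cell (`C.upper`, the `P`-cells per `Pad4TowerCrossPhase`) is a ceiling unit cell `[6I+ℓ_u]⁴`. Machine ×1, THIRD CODE, SEARCH-FREE: gs-eng-2 g53's
◇₈ peel (kit j309861; 17 rounds of propagation-only failed-literal elimination on the `H₁` orbit-CNF eliminate 97 541 ∕ 97 660 orbit literals; the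
sole surviving FC orbit literal is `P[6I+ℓ_u]⁴`, `N[ℓ_u]⁴` does NOT survive). NOT ×2: (W) stays the typed target of record until a `non_pceiling_fc`
presence run (R14.22 (1): one follow-up only after j310554's verdict). (W′) ⇒ (W): `seedDiagUnit_of_pCeilingUnit`. -/
def SeedFCPCeilingUnitDiamond8G1H1 : Prop :=
  ∀ C : MConfig, C.InDiamond 8 → C.G1Closed → C.StaticH1 →
    ∀ Z, FCc Z → (Z ∈ C.lower → False) ∧ (Z ∈ C.upper → Z.IsCeilingUnit8)

/-- **(W′) ⇒ (W), PROVED** (two lines). [bc5-plan g8 sketch v3.2, verbatim] -/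
theorem seedDiagUnit_of_pCeilingUnit (h : SeedFCPCeilingUnitDiamond8G1H1) : SeedFCDiagonalUnitDiamond8G1H1 := by
  intro C hU hG hS Z hZ hfc
  rcases hZ with hZ | hZ
  · exact ((h C hU hG hS Z hfc).1 hZ).elim
  · exact MCell.isDiagUnit8_of_isCeilingUnit8 ((h C hU hG hS Z hfc).2 hZ)

/-- hence (W′) ⇒ (T) by composition. -/
theorem seedB1Odd_of_pCeilingUnit (h : SeedFCPCeilingUnitDiamond8G1H1) : SeedB1OddDiamond8G1H1 :=
  seedB1Odd_of_diagUnit (seedDiagUnit_of_pCeilingUnit h)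

/-- hence (W′) ⇒ (S) by composition. -/
theorem seedB1_of_pCeilingUnit (h : SeedFCPCeilingUnitDiamond8G1H1) : SeedB1Diamond8G1H1 :=
  seedB1_of_diagUnit (seedDiagUnit_of_pCeilingUnit h)

/-- **the CASE-LIST ASSEMBLY for (W′), PROVED**: every present FC `N`-cell and every present non-ceiling-unit FC `P`-cell is contradictory under
◇₈ + `G₁` + `H₁` ⇒ (W′). [classical case split on the `P` side; bc5-plan g8 sketch v3.2, verbatim] -/
theorem seedPCeilingUnit_of_cases
    (hN : ∀ C : MConfig, C.InDiamond 8 → C.G1Closed → C.StaticH1 → ∀ Z ∈ C.lower, FCc Z → False)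
    (hP : ∀ C : MConfig, C.InDiamond 8 → C.G1Closed → C.StaticH1 → ∀ P ∈ C.upper, FCc P → ¬ P.IsCeilingUnit8 → False) :
    SeedFCPCeilingUnitDiamond8G1H1 :=
  fun C hU hG hS Z hfc => ⟨fun hZ => hN C hU hG hS Z hZ hfc,
    fun hZ => Classical.by_contradiction (hP C hU hG hS Z hZ hfc)⟩

/-! ## §4 LINE 5 SEED (B2) at ◇₈, `G₁`, `H₂ = H₁` (r3 FINAL): «static-clean + an FC class present ⇒ the Ψ-clause FAILS» — TYPED STATEMENT,
machine ×2 at instance level, NO proof; folded into this seed file per director-hodge g14 R14.32 (1) («`StaticH2 := StaticH1` ADOPTED … no new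
family file, no separate claim for a one-line abbreviation») -/

/-- **`StaticH2 := StaticH1`** — the `H₂` static bundle of LINE 5 (i) r3 EQUALS `H₁ = RULE-D + {X⁺, A2I⁻}` (bc5-plan g8 r3 FINAL, cell INBOX l.32781;
director-hodge g14 R14.32 (1)). A one-line abbreviation, kept for the template's name (bc5-plan LINE5-SEEDS-TEMPLATE 35a591490aa3302d §0 (B2)). -/
abbrev MConfig.StaticH2 (C : MConfig) : Prop := C.StaticH1

/-- **an FC class is present** at either level (the encoder's FC-mass clause `with_fc`: «some FC class present»). Bounded, decidable. -/
abbrev MConfig.HasAnyFC (C : MConfig) : Prop := (∃ Z ∈ C.lower, FCc Z) ∨ (∃ P ∈ C.upper, FCc P)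

/-- a signed FC occurrence is a present FC class. -/
theorem MConfig.hasAnyFC_of_hasSignedFC {C : MConfig} {κ : Fin 16} {s : ℤ} (h : C.HasSignedFC κ s) : C.HasAnyFC := by
  rcases h with ⟨Z, hZ, hfc, -, -⟩ | ⟨P, hP, hfc, -, -⟩
  · exact Or.inl ⟨Z, hZ, hfc⟩
  · exact Or.inr ⟨P, hP, hfc⟩

/-- the FC-CORE block carries an FC class (FC-mass is implied by the block). -/
theorem MConfig.hasAnyFC_of_fcCoreBlock {C : MConfig} (h : C.FCCoreBlock) : C.HasAnyFC := by
  rcases h with ⟨_, -, h⟩ | ⟨_, -, h⟩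
  · exact MConfig.hasAnyFC_of_hasSignedFC h.1
  · exact MConfig.hasAnyFC_of_hasSignedFC h.1

/-- **LINE 5 SEED (B2) `SeedB2Diamond8G1H2` at ◇₈, `G₁`, `H₂ = H₁`** (faithful form, bc5-plan NOD (P2) l.32516: «FC present → ¬PsiClause»); TYPED
STATEMENT IN HYPOTHESIS FORM — NOT asserted, no `axiom`, no `sorry`, NO proof: for every two-level configuration of 𝔅(μ₄) cells inside ◇₈ whose
levels are each `G₁`-closed, `StaticH2 = StaticH1` (RULE-D closure ∧ X⁺-closed ∧ A2I⁻-closed) TOGETHER WITH a present fully charged class excludes the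
Ψ-clause `MConfig.PsiClause` ((B) `Pad4TowerPsiSubA1`: the signed Ψ on the support is neither all-zero nor two-signed ⟺ clause holds). EVIDENCE
(instance level, not a proof): kit j305149 `W-CORE-FAM-D8-G1-v19` r3 FINAL (bc5-plan g8 l.32781, done ok 15:09:46Z, 5 h 33 min, peak 83.8 GB;
director R14.32 l.32782; variant `full` = STATIC + FC-mass + Ψ): control `all` 12 532 286 ∕ 60 602 059 kissat UNSAT 2 362 s; minus-FC1 UNSAT 1 194 s,
minus-X⁻ UNSAT 1 678 s, minus-A2I⁺ UNSAT 2 542 s (not load-bearing); **minus-X⁺ SAT 50 s** (the full support, all 97 660 orbits, Ψ-balanced),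
**minus-A2I⁻ SAT 91 s** (29 orbits = 1 048 classes whose FC classes are exactly the four floor diagonal unit orbits `N[ℓ_u]⁴`); **cadical on the
minimal CNF 12 276 318 ∕ 50 943 884 (= STATIC(H₁) + FC-mass + Ψ) UNSAT 837 s ⇒ `H₂ = RULE-D + {X⁺, A2I⁻} = H₁ = H_odd`, ×2.** Reason of record for
`H₂ = H₁`: gs-eng-2 LEMMA Ψ-LINE §2 92f862dc99a9944c. Buys NO all-heights ∕ all-anchors statement, no strong minimality, no proof of any seed. -/
def SeedB2Diamond8G1H2 : Prop :=
  ∀ C : MConfig, C.InDiamond 8 → C.G1Closed → C.StaticH2 → C.HasAnyFC → ¬ C.PsiClause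

/-- the same seed under the STRONGER bundle of all four instance families (`StaticFour`) — a WEAKER statement. -/
def SeedB2Diamond8G1Static4 : Prop :=
  ∀ C : MConfig, C.InDiamond 8 → C.G1Closed → C.StaticFour → C.HasAnyFC → ¬ C.PsiClause

/-- the four-family bundle contains `H₂` (= `H₁`: `MConfig.staticH1_of_staticFour`). -/
theorem MConfig.staticH2_of_staticFour {C : MConfig} (h : C.StaticFour) : C.StaticH2 :=
  MConfig.staticH1_of_staticFour h

/-- the four-family (B2) seed follows from the `H₂` one. -/
theorem seedB2Static4_of_H2 (h : SeedB2Diamond8G1H2) : SeedB2Diamond8G1Static4 :=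
  fun C hU hG hS => h C hU hG (MConfig.staticH2_of_staticFour hS)

/-- **COROLLARY OF (B2), GRANTED THE SEED (PROVED modulo the seed).** If `SeedB2Diamond8G1H2` holds, then on every `G₁`-closed `H₂`-static two-level
support in ◇₈ every multiplicity vector POSITIVE on the support whose weighted class tensor passes the class screen (A1) has `μ = wch(eeee) = 0`.
[(B) `MConfig.psiClause_of_classScreen` gives the Ψ-clause; (S) `fcCoreBlock_of_classScreen` + `hasAnyFC_of_fcCoreBlock` give an FC class when
`μ ≠ 0`; the seed forbids both together.] -/
theorem wch_eWord_eq_zero_of_seedB2 (hseed : SeedB2Diamond8G1H2) (C : MConfig) (hU : C.InDiamond 8) (hG : C.G1Closed)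
    (hS : C.StaticH2) (mN mP : MCell → ℤ) (hmN : ∀ Z ∈ C.lower, 0 < mN Z) (hmP : ∀ P ∈ C.upper, 0 < mP P)
    (hA : ClassScreen (C.wch mN mP)) : C.wch mN mP eWord = 0 := by
  by_contra hμ
  obtain ⟨hN, hP⟩ := MConfig.axisCell_of_inDiamond hU
  exact hseed C hU hG hS (MConfig.hasAnyFC_of_fcCoreBlock (C.fcCoreBlock_of_classScreen mN mP hN hP hmN hmP hA hμ))
    (C.psiClause_of_classScreen mN mP hmN hmP hA)

/-- the same from the four-family seed under the four-family bundle. -/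
theorem wch_eWord_eq_zero_of_seedB2Static4 (hseed : SeedB2Diamond8G1Static4) (C : MConfig) (hU : C.InDiamond 8) (hG : C.G1Closed)
    (hS : C.StaticFour) (mN mP : MCell → ℤ) (hmN : ∀ Z ∈ C.lower, 0 < mN Z) (hmP : ∀ P ∈ C.upper, 0 < mP P)
    (hA : ClassScreen (C.wch mN mP)) : C.wch mN mP eWord = 0 := by
  by_contra hμ
  obtain ⟨hN, hP⟩ := MConfig.axisCell_of_inDiamond hU
  exact hseed C hU hG hS (MConfig.hasAnyFC_of_fcCoreBlock (C.fcCoreBlock_of_classScreen mN mP hN hP hmN hmP hA hμ))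
    (C.psiClause_of_classScreen mN mP hmN hmP hA)

/-! ## §5 Probes (`decide`; the new definitions compute — NOT evidence about any support of record) -/

section Probes

/-- `IsDiagUnit8` computes: `[ℓ_i]⁴` and `[6I+ℓ₋₁]⁴` are diagonal unit cells and lie in ◇₈ (the ceiling unit cell ON the ceiling line);
`[ℓ₁|ℓ₁|ℓ₁|ℓ_i]` and `[2ℓ₁]⁴` are not diagonal unit cells. [kernel, `decide` after `unfold`] -/
theorem isDiagUnit8_probe : (mcellOf (lpt 1 1) (lpt 1 1) (lpt 1 1) (lpt 1 1)).IsDiagUnit8 ∧ (mcellOf (cu8 2) (cu8 2) (cu8 2) (cu8 2)).IsDiagUnit8 ∧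
    (mcellOf (cu8 2) (cu8 2) (cu8 2) (cu8 2)).InDiamond 8 ∧
    ¬ (mcellOf (lpt 1 0) (lpt 1 0) (lpt 1 0) (lpt 1 1)).IsDiagUnit8 ∧ ¬ (mcellOf (lpt 2 0) (lpt 2 0) (lpt 2 0) (lpt 2 0)).IsDiagUnit8 := by
  unfold MCell.IsDiagUnit8; decide

/-- `IsCeilingUnit8` computes: `[6I+ℓ₋ᵢ]⁴` is a ceiling unit cell; the floor unit cell `[ℓ₁]⁴` is not (it is a diagonal unit cell).
[kernel, `decide` after `unfold`] -/
theorem isCeilingUnit8_probe : (mcellOf (cu8 3) (cu8 3) (cu8 3) (cu8 3)).IsCeilingUnit8 ∧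
    ¬ (mcellOf (lpt 1 0) (lpt 1 0) (lpt 1 0) (lpt 1 0)).IsCeilingUnit8 ∧ (mcellOf (lpt 1 0) (lpt 1 0) (lpt 1 0) (lpt 1 0)).IsDiagUnit8 := by
  unfold MCell.IsCeilingUnit8 MCell.IsDiagUnit8; decide

set_option synthInstance.maxSize 8192 in
set_option synthInstance.maxHeartbeats 2000000 in -- large decidable instances, as in the family files
/-- `HasAnyFC` and the Ψ-clause compute: `diagFour = {[ℓ_u]⁴}` at `N` carries FC classes and its signed Ψ is one-signed (every `[ℓ_u]⁴` has
`Ψ = C± = 1 > 0` at level `N`, nothing negative) — so the Ψ-clause FAILS there, as the seed's conclusion wants (its hypothesis `StaticH2` fails too: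
RULE D, `diagFour_not_staticH1`). [kernel, `decide`] -/
theorem seedB2_probe : diagFour.HasAnyFC ∧ diagFour.HasPsiPos ∧ ¬ diagFour.HasPsiNeg ∧ ¬ diagFour.PsiClause := by
  refine ⟨?_, ?_, ?_, ?_⟩ <;> decide +kernel

end Probes

end Summit.Ventures.HSemireg.Pad4Tower
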